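import Summits.KontsevichZagierPeriods.KontsevichZagierPeriods.Theses.CoactionDevissage
import Summits.KontsevichZagierPeriods.KontsevichZagierPeriods.Theorems.FurushoPentagonSectorToKernelOfLeaves

/-!
# `RationalKernelOfCubes` (stmt-KontsevichZagierPeriods-17690, route CoactionDevissage) — proof

`RationalKernelOfCubes : CubeResolution → AyoubEffectiveCubeKernel → RationalKernel`, the SPLIT GLUE
of the route's deciding crux `RationalKernel` (stmt-3165; Conjecture 1 with `ℚ`-coefficients: every
formal `ℤ`-combination `c` of integral representations with `KZ.eval c = 0` has a non-zero integer
multiple in `KZ.relations`) along Ayoub's compact presentation (crux-strategist re-audit r1, BC2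
redirect; the two children are the hub-wide items stmt-17978 / stmt-18116):

* X₁ `CubeResolution` — geometry inside the rules: every integral representation is congruent
  modulo `KZ.relations` to a `ℤ`-combination of tame cube classes `[[0,1]ⁿ, f]`, `f` real analytic
  on a neighbourhood of the closed cube; import-free in the route file, and since
  `{x | ∀ i, 0 ≤ x i ∧ x i ≤ 1} = ReducedPeriodRing.unitCube n` and the generated subgroup is
  `ReducedPeriodRing.cubicalSpan` by definition, it is definitionally the hypothesis `h1` of the
  landed seven-step transfer `kzKernel_of_cubeResolution_of_ayoubKernel`
  (`Theorems/FurushoPentagonSectorToKernelOfLeaves.lean`);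
* X₂ `AyoubEffectiveCubeKernel` — J. Ayoub, Ann. of Math. 181 (2015) Conj. 1.1 at `k = ℚ`: the
  kernel of `∫_{[0,1]^∞}` on `𝒪_{ℚ-alg}(𝔻̄^∞)` is the `ℚ`-span of the type-(a) elements; literally
  the hypothesis `h6` of the same transfer.

Proof: the transfer (resolve into the tame cubical span → merge to one tame cube class → make it
Ayoub-admissible inside the moves → `∫ = 0` by soundness → real Stokes form from X₂ →
`ℚ`-semialgebraicity of the primitives → padding + calibration) yields the KERNEL FORM of
Conjecture 1, `∀ c, KZ.eval c = 0 → c ∈ KZ.relations`, whence `RationalKernel` with the multiple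
`n = 1`. The planner's published sorry-free proof (`Cruxes/RationalKernel/SplitGlue.lean`,
`RationalKernel_of_subs` / `rationalKernelOfCubes_proof`) re-homed under `Theorems/` by lead c10 of
crux stmt-KontsevichZagierPeriods-9129 (banking), exactly as the landed twin
`Theorems/HermiteRigidityReductionRigidityOfCubes.lean` (stmt-18142).
References: M. Kontsevich, D. Zagier, *Periods* (2001), §1.2 Conjecture 1, §4.1; J. Ayoub, Ann. of
Math. 181 (2015), Conj. 1.1, Rem. 1.2; J. Ayoub, EMS Newsl. 91 (2014), Def. 9–10, Prop. 11,
Rem. 12–13; A. Huber, S. Müller-Stach, *Periods and Nori Motives* (2017), Thm. 12.2.1, §13.1.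
[folklore]
-/

noncomputable section

namespace Summit.KontsevichZagierPeriods.CoactionDevissage

namespace RationalKernelOfCubes

open Literature.NumberTheory.Transcendental
open Summit.KontsevichZagierPeriods.FurushoPentagon.SectorToKernel
  (kzKernel_of_cubeResolution_of_ayoubKernel)

/-- **The kernel form of Conjecture 1 from the two children of the split**, `CubeResolution` and
`AyoubEffectiveCubeKernel` (both unfolded): every formal `ℤ`-combination of integral
representations of value `0` lies in `KZ.relations`. The import-free cube
`{x | ∀ i, 0 ≤ x i ∧ x i ≤ 1}` of the route file is `ReducedPeriodRing.unitCube n` and the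
generated subgroup is `ReducedPeriodRing.cubicalSpan`, definitionally, so `CubeResolution` is
repackaged as the cubical resolution hypothesis of the landed composition
`kzKernel_of_cubeResolution_of_ayoubKernel` (steps (1)–(7) of the seam).
[Ayoub 2015, Conj. 1.1; Ayoub 2014, Rem. 12–13; Kontsevich–Zagier 2001, §1.2] [folklore] -/
theorem kernelForm_of_cubes
    (h1 : Summit.KontsevichZagierPeriods.KontsevichZagierPeriods.Theses.CoactionDevissage.CubeResolution)
    (h6 : Summit.KontsevichZagierPeriods.KontsevichZagierPeriods.Theses.CoactionDevissage.AyoubEffectiveCubeKernel) :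
    ∀ c : KZ.FormalRep, KZ.eval c = 0 → c ∈ KZ.relations := by
  unfold Summit.KontsevichZagierPeriods.KontsevichZagierPeriods.Theses.CoactionDevissage.CubeResolution
    at h1
  unfold
    Summit.KontsevichZagierPeriods.KontsevichZagierPeriods.Theses.CoactionDevissage.AyoubEffectiveCubeKernel
    at h6
  refine kzKernel_of_cubeResolution_of_ayoubKernel (fun N u => ?_) h6
  obtain ⟨c, hc, huc⟩ := h1 N u
  exact ⟨c, hc, huc⟩

end RationalKernelOfCubes

/-- **`RationalKernelOfCubes`** (route CoactionDevissage, stmt-KontsevichZagierPeriods-17690):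
`CubeResolution → AyoubEffectiveCubeKernel → RationalKernel`. The two children give the kernel
form of Conjecture 1 (`RationalKernelOfCubes.kernelForm_of_cubes`, the seven-step seam), and the
kernel form gives `RationalKernel` with the multiple `n = 1` (`one_nsmul`).
[Kontsevich–Zagier 2001, §1.2 Conjecture 1] [Ayoub 2015, Conj. 1.1] [folklore] -/
theorem rationalKernelOfCubes_proof :
    Summit.KontsevichZagierPeriods.KontsevichZagierPeriods.Theses.CoactionDevissage.RationalKernelOfCubes := by
  unfold Summit.KontsevichZagierPeriods.KontsevichZagierPeriods.Theses.CoactionDevissage.RationalKernelOfCubes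
  intro h1 h6 c hc
  exact ⟨1, one_ne_zero, by simpa using RationalKernelOfCubes.kernelForm_of_cubes h1 h6 c hc⟩

end Summit.KontsevichZagierPeriods.CoactionDevissage
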